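import Summits.AtomisticToContinuum.HydrodynamicLimit.Theorems.CollisionIsometryCLTAdaptedWeightCLTTLPastDampingHandover
import Summits.AtomisticToContinuum.HydrodynamicLimit.Theorems.CollisionIsometryCLTAdaptedWeightCLTTLReductionFlow
import Literature.Analysis.FluidPDE.ConfinedHardSphereFlowShortBad

/-!
# Stub `stub_pastDamping` of the line `contact-source-duhamel` — helper file: LOCALITY OF THE
CARRIER MASSES along the fold (crux `CollisionIsometryCLT.AdaptedWeightCLT`,
stmt-AtomisticToContinuum-14868, `--supports`)

The dynamical input of the PAST estimate that neither column depolarisation nor the velocity tails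
contain (the re-cut of wave 1, `…TLPastDampingInput.lean`), on top of the one-step facts of
`…TLPastDampingHandover.lean`: the basis carrier masses `ω_{ki}(m)` (column sums `3`, row sums `3`)
satisfy the MASS-WEIGHTED LOCALITY BOUND

  `Σ_k Σ_i ω_{ki}(m) · d(x_i(s), x_k(s)) ≤ 6 S̄ Δ + 6 ε_N m`,   `S̄ = √((N+1) Σ_j ‖v_j‖²)`,

for the fold of the line window `[s − Δ, s]` (`Δ = winLen N s`, `m` fold steps) restarted along a good
orbit of a hard-sphere flow, `x(s)` the positions at time `s` (`locality_win`). Proof: a potential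
`Ψ_l = Σ_{k,i} ω_{ki}(l) d(x_i^{(l)}, x_k^{(l)})` over the post-collisional states of the Alexander
construction (`psiAt`); one fold step costs `6 τ_l S̄` by the flights (every carrier and every
source moves by `≤ τ_l ‖v‖`, row and column sums `3`, `Σ_j ‖v_j‖ ≤ S̄` by energy conservation along
the fold) and `6 ε_N` by the hand-over (mass crosses only the reflected pair, at contact); the
instants add up to at most `Δ` (`Alexander.FwdGood.exists_segment`), the final free flight to the
end of the window costs `6 S̄ (Δ − t_m)`, and the fold started on a good orbit is forward-good with
forward flow the orbit (`IsHardSphereTrajectory.fwdGood_apply_zero`, `fwdFlow_apply_zero`).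
-/

namespace Summit.AtomisticToContinuum.HydrodynamicLimit.Theorems.ContactSourceDuhamel.TimeLocal
namespace PastDamping

open scoped BigOperators Topology Classical MeasureTheory ENNReal InnerProductSpace
open Filter Set MeasureTheory
open Literature.Analysis.FluidPDE
open Literature.MathematicalPhysics.KineticTheory (hsDiameter hsDiameter_pos hsDiameter_le)
open Duhamel
open Summit.AtomisticToContinuum.HydrodynamicLimit.Theorems.AdaptedWeightCLTNegative (baseV_apply)
open ColumnDepolarisation (pieceCar pieceVec norm_sq_projV_add_coprojV)

noncomputable section

variable {σ : ℝ} {N : ℕ} {y : Cfg N}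

/-! ## The locality potential -/

/-- The velocity scale `S̄(y) = √((N+1) Σ_j ‖v_j‖²)`, a bound for `Σ_j ‖v_j‖` along the fold. -/
def sBar (N : ℕ) (y : Cfg N) : ℝ := Real.sqrt (((N + 1 : ℕ) : ℝ) * ∑ j, ‖(y j).2‖ ^ 2)

/-- `0 ≤ S̄`. -/
theorem sBar_nonneg (y : Cfg N) : 0 ≤ sBar N y := Real.sqrt_nonneg _

/-- `Σ_j ‖v_j^{(l)}‖ ≤ S̄(y)` for every number of fold steps (Cauchy–Schwarz and energy conservation
along the fold, `Reduction.sum_sq_velAfter`). -/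
theorem sum_norm_velAfter_le (l : ℕ) : ∑ j, ‖velAfter σ N y l j‖ ≤ sBar N y := by
  refine Real.le_sqrt_of_sq_le ?_
  have h := Finset.sum_mul_sq_le_sq_mul_sq Finset.univ (fun _ : Fin (N + 1) => (1 : ℝ))
    (fun j => ‖velAfter σ N y l j‖)
  simp only [one_mul, one_pow, Finset.sum_const, Finset.card_univ, Fintype.card_fin, nsmul_eq_mul,
    mul_one] at h
  rwa [Reduction.sum_sq_velAfter] at h

/-- The ω-MASS ON THE REFLECTED PAIR of fold step `l` coming from site `k` (`0` at an identity step). -/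
def pairMass (σ : ℝ) (N : ℕ) (y : Cfg N) (l : ℕ) (k : Fin (N + 1)) : ℝ :=
  match stepPair σ N y l with
  | none => 0
  | some pq => omegaAt σ N y l k pq.1 + omegaAt σ N y l k pq.2

/-- `0 ≤ pairMass`. -/
theorem pairMass_nonneg (l : ℕ) (k : Fin (N + 1)) : 0 ≤ pairMass σ N y l k := by
  unfold pairMass
  rcases stepPair σ N y l with _ | ⟨p, q⟩
  · exact le_rfl
  · exact add_nonneg (omegaAt_nonneg l k p) (omegaAt_nonneg l k q)

/-- Summed over the sites, the mass on the reflected pair is at most `6` (row sums `3`). -/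
theorem sum_pairMass_le (l : ℕ) : ∑ k, pairMass σ N y l k ≤ 6 := by
  unfold pairMass
  rcases stepPair σ N y l with _ | ⟨p, q⟩
  · simp
  · rw [Finset.sum_add_distrib, sum_sites_omegaAt, sum_sites_omegaAt]
    norm_num

/-- **One transport step at the level of `ω`**: paired with a function whose increment across the
reflected pair is at most `L`, the basis masses after step `l` exceed those before by at most
`L · pairMass`. -/
theorem sum_omegaAt_succ_mul_le (l : ℕ) (k : Fin (N + 1)) (f : Fin (N + 1) → ℝ) {L : ℝ}
    (hL : ∀ p q, stepPair σ N y l = some (p, q) → |f p - f q| ≤ L) :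
    ∑ i, omegaAt σ N y (l + 1) k i * f i ≤ ∑ i, omegaAt σ N y l k i * f i + L * pairMass σ N y l k := by
  have hsw : ∀ m, ∑ i, omegaAt σ N y m k i * f i =
      ∑ c : Fin 3, ∑ i, massAt σ N y m k (baseV c) i * f i := by
    intro m
    simp only [omegaAt, Finset.sum_mul]
    rw [Finset.sum_comm]
  rw [hsw, hsw]
  refine (Finset.sum_le_sum fun c _ => sum_massAt_succ_mul_le (σ := σ) (y := y) l k (baseV c) f).trans
    ?_
  rw [Finset.sum_add_distrib]
  refine add_le_add_right ?_ _
  unfold jumpAt pairMass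
  rcases hst : stepPair σ N y l with _ | ⟨p, q⟩
  · simp
  · simp only
    rw [← Finset.sum_mul, Finset.sum_add_distrib, mul_comm]
    refine mul_le_mul_of_nonneg_right (hL p q hst) ?_
    exact add_nonneg (omegaAt_nonneg l k p) (omegaAt_nonneg l k q)

/-- The LOCALITY POTENTIAL after `l` fold steps: `Ψ_l = Σ_k Σ_i ω_{ki}(l) d(x_i^{(l)}, x_k^{(l)})`,
positions taken in the `l`-th post-collisional state. -/
def psiAt (σ : ℝ) (N : ℕ) (y : Cfg N) (l : ℕ) : ℝ :=
  ∑ k, ∑ i, omegaAt σ N y l k i * Torus.euclidDist (stA σ N y l i).1 (stA σ N y l k).1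

/-- `Ψ_0 = 0`: before any step all mass sits on its source. -/
theorem psiAt_zero : psiAt σ N y 0 = 0 := by
  refine Finset.sum_eq_zero fun k _ => Finset.sum_eq_zero fun i _ => ?_
  by_cases hik : i = k
  · rw [hik, Torus.euclidDist_self, mul_zero]
  · have h0 : omegaAt σ N y 0 k i = 0 := by
      refine Finset.sum_eq_zero fun c _ => ?_
      rw [massAt, tTransport_zero, Pi.single_eq_of_ne hik, trT_zero]
    rw [h0, zero_mul]

/-- **Flights and hand-over with positions read anywhere**: for any configuration `X` whose particles
are within `δ_j` of those of the `l`-th state, pairing `ω(l)` with the mutual distances in `X` costs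
at most `Ψ_l + Σ-weighted displacements`. Used twice: for `pre l` (one fold step) and for the final
free flight to the end of the window. -/
theorem sum_omegaAt_mul_dist_le (l : ℕ) (X : Cfg N) {δ : Fin (N + 1) → ℝ}
    (hδ : ∀ j, Torus.euclidDist (X j).1 (stA σ N y l j).1 ≤ δ j) :
    ∑ k, ∑ i, omegaAt σ N y l k i * Torus.euclidDist (X i).1 (X k).1 ≤
      psiAt σ N y l + 3 * ∑ i, δ i + 3 * ∑ k, δ k := by
  have htri : ∀ i k, Torus.euclidDist (X i).1 (X k).1 ≤
      Torus.euclidDist (stA σ N y l i).1 (stA σ N y l k).1 + δ i + δ k := by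
    intro i k
    have h1 := Torus.euclidDist_triangle (X i).1 (stA σ N y l i).1 (X k).1
    have h2 := Torus.euclidDist_triangle (stA σ N y l i).1 (stA σ N y l k).1 (X k).1
    have h3 := hδ i
    have h4 := hδ k
    rw [Torus.euclidDist_comm] at h4
    linarith
  calc ∑ k, ∑ i, omegaAt σ N y l k i * Torus.euclidDist (X i).1 (X k).1
      ≤ ∑ k, ∑ i, omegaAt σ N y l k i *
          (Torus.euclidDist (stA σ N y l i).1 (stA σ N y l k).1 + δ i + δ k) :=
        Finset.sum_le_sum fun k _ => Finset.sum_le_sum fun i _ =>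
          mul_le_mul_of_nonneg_left (htri i k) (omegaAt_nonneg l k i)
    _ = psiAt σ N y l + ∑ i, (∑ k, omegaAt σ N y l k i) * δ i +
          ∑ k, (∑ i, omegaAt σ N y l k i) * δ k := by
        simp only [mul_add, Finset.sum_add_distrib, Finset.sum_mul, psiAt]
        rw [Finset.sum_comm (f := fun k i => omegaAt σ N y l k i * δ i)]
    _ = psiAt σ N y l + 3 * ∑ i, δ i + 3 * ∑ k, δ k := by
        simp only [sum_sites_omegaAt, sum_carriers_omegaAt, ← Finset.mul_sum]

/-- **One fold step of the potential**: `Ψ_{l+1} ≤ Ψ_l + 6 τ_l S̄ + 6 ε_N` (flights move every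
carrier and every source by `≤ τ_l ‖v‖`, row and column sums are `3`; the hand-over moves mass
across the contact distance only). -/
theorem psiAt_succ_le (hG : (Torus.geometry (Fin 3)).IsHardSphereRegular (hsDiameter σ N))
    (hσ : 0 < σ) (l : ℕ) :
    psiAt σ N y (l + 1) ≤
      psiAt σ N y l + 6 * (tauA σ N y l).toReal * sBar N y + 6 * hsDiameter σ N := by
  have hτ0 : 0 ≤ (tauA σ N y l).toReal := ENNReal.toReal_nonneg
  have hε0 : 0 ≤ hsDiameter σ N := (hsDiameter_pos hσ N).le
  have hS := sum_norm_velAfter_le (σ := σ) (y := y) l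
  -- after the step the positions are those of `pre l`
  have hpos : psiAt σ N y (l + 1) =
      ∑ k, ∑ i, omegaAt σ N y (l + 1) k i * Torus.euclidDist (pre σ N y l i).1 (pre σ N y l k).1 := by
    simp only [psiAt, stA_succ_fst]
  -- the hand-over: per site, the masses after the step against the distances in `pre l`
  have hjump : ∀ k, ∑ i, omegaAt σ N y (l + 1) k i * Torus.euclidDist (pre σ N y l i).1 (pre σ N y l k).1 ≤
      ∑ i, omegaAt σ N y l k i * Torus.euclidDist (pre σ N y l i).1 (pre σ N y l k).1 +
        hsDiameter σ N * pairMass σ N y l k := by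
    intro k
    refine sum_omegaAt_succ_mul_le l k _ fun p q hst => ?_
    have h1 := Torus.euclidDist_triangle (pre σ N y l p).1 (pre σ N y l q).1 (pre σ N y l k).1
    have h2 := Torus.euclidDist_triangle (pre σ N y l q).1 (pre σ N y l p).1 (pre σ N y l k).1
    have h3 := euclidDist_pre_of_stepPair hst
    have h4 : Torus.euclidDist (pre σ N y l q).1 (pre σ N y l p).1 = hsDiameter σ N := by
      rw [Torus.euclidDist_comm]; exact h3
    rw [abs_le]
    constructor <;> linarith
  -- the flights: the masses before the step against the distances in `pre l`
  have hflight := sum_omegaAt_mul_dist_le (σ := σ) (y := y) l (pre σ N y l)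
    (fun j => euclidDist_pre_stA_le hG l j)
  rw [hpos]
  calc ∑ k, ∑ i, omegaAt σ N y (l + 1) k i * Torus.euclidDist (pre σ N y l i).1 (pre σ N y l k).1
      ≤ ∑ k, (∑ i, omegaAt σ N y l k i * Torus.euclidDist (pre σ N y l i).1 (pre σ N y l k).1 +
          hsDiameter σ N * pairMass σ N y l k) := Finset.sum_le_sum fun k _ => hjump k
    _ = (∑ k, ∑ i, omegaAt σ N y l k i * Torus.euclidDist (pre σ N y l i).1 (pre σ N y l k).1) +
          hsDiameter σ N * ∑ k, pairMass σ N y l k := by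
        rw [Finset.sum_add_distrib, Finset.mul_sum]
    _ ≤ (psiAt σ N y l + 3 * ∑ i, (tauA σ N y l).toReal * ‖velAfter σ N y l i‖ +
          3 * ∑ k, (tauA σ N y l).toReal * ‖velAfter σ N y l k‖) + hsDiameter σ N * 6 :=
        add_le_add hflight (mul_le_mul_of_nonneg_left (sum_pairMass_le l) hε0)
    _ = psiAt σ N y l + 6 * (tauA σ N y l).toReal * ∑ j, ‖velAfter σ N y l j‖ +
          6 * hsDiameter σ N := by
        rw [← Finset.mul_sum]; ring
    _ ≤ psiAt σ N y l + 6 * (tauA σ N y l).toReal * sBar N y + 6 * hsDiameter σ N := by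
        have := mul_le_mul_of_nonneg_left hS (mul_nonneg (by norm_num : (0:ℝ) ≤ 6) hτ0)
        linarith

/-- **The potential after `l` steps**: `Ψ_l ≤ 6 S̄ Σ_{l' < l} τ_{l'} + 6 ε_N l`. -/
theorem psiAt_le (hG : (Torus.geometry (Fin 3)).IsHardSphereRegular (hsDiameter σ N))
    (hσ : 0 < σ) (l : ℕ) :
    psiAt σ N y l ≤ 6 * sBar N y * ∑ l' ∈ Finset.range l, (tauA σ N y l').toReal +
      6 * hsDiameter σ N * l := by
  induction l with
  | zero => simp [psiAt_zero]
  | succ l ih =>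
    have h := psiAt_succ_le (y := y) hG hσ l
    rw [Finset.sum_range_succ]
    push_cast
    nlinarith [h, ih]

/-! ## The locality bound over a window -/

/-- **Locality of the carrier masses along the fold** (forward-good datum, window `[0, Δ]`): with
`m = steps σ N y Δ` fold steps and `X = fwdFlow y Δ` the configuration at the end of the window,
`Σ_k Σ_i ω_{ki}(m) d(X_i, X_k) ≤ 6 S̄(y) Δ + 6 ε_N m`. -/
theorem locality_fold (hG : (Torus.geometry (Fin 3)).IsHardSphereRegular (hsDiameter σ N))
    (hσ : 0 < σ) {Δ : ℝ} (hΔ : 0 ≤ Δ)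
    (hgood : Alexander.FwdGood (Torus.geometry (Fin 3)) (hsDiameter σ N) y) :
    ∑ k, ∑ i, omegaAt σ N y (steps σ N y Δ) k i *
        Torus.euclidDist (Alexander.fwdFlow (Torus.geometry (Fin 3)) (hsDiameter σ N) y Δ i).1
          (Alexander.fwdFlow (Torus.geometry (Fin 3)) (hsDiameter σ N) y Δ k).1 ≤
      6 * sBar N y * Δ + 6 * hsDiameter σ N * steps σ N y Δ := by
  obtain ⟨m, h1, h2⟩ := hgood.exists_segment Δ
  have hm : steps σ N y Δ = m := Alexander.collisionCount_eq_of_segment h1 h2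
  set T := Alexander.collisionInstant (Torus.geometry (Fin 3)) (hsDiameter σ N) y m with hT
  have hTfin : T ≠ ∞ := ne_top_of_le_ne_top ENNReal.ofReal_ne_top h1
  have hTle : T.toReal ≤ Δ := ENNReal.toReal_le_of_le_ofReal hΔ h1
  have hX : Alexander.fwdFlow (Torus.geometry (Fin 3)) (hsDiameter σ N) y Δ =
      freeFlight (Torus.geometry (Fin 3)) (Δ - T.toReal) (stA σ N y m) :=
    Alexander.fwdFlow_eq_of_segment h1 h2
  -- the instants add up
  have hsum : ∑ l' ∈ Finset.range m, (tauA σ N y l').toReal = T.toReal := by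
    rw [hT, Alexander.collisionInstant, ENNReal.toReal_sum]
    intro l' hl'
    refine ne_top_of_le_ne_top hTfin ?_
    rw [hT, Alexander.collisionInstant]
    exact Finset.single_le_sum (f := fun l' => tauA σ N y l') (fun _ _ => zero_le) hl'
  -- the final free flight
  have hδ : ∀ j, Torus.euclidDist (Alexander.fwdFlow (Torus.geometry (Fin 3)) (hsDiameter σ N) y Δ j).1
      (stA σ N y m j).1 ≤ (Δ - T.toReal) * ‖velAfter σ N y m j‖ := by
    intro j
    have hv : (stA σ N y m j).2 = velAfter σ N y m j := congrFun (FlowDict.vel_stateAfter hG y m) j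
    rw [hX]
    show Torus.euclidDist ((Torus.geometry (Fin 3)).translate (stA σ N y m j).1
      ((Δ - T.toReal) • (stA σ N y m j).2)) (stA σ N y m j).1 ≤ _
    rw [Torus.geometry_translate, hv]
    refine (euclidDist_translate_le _ _).trans (le_of_eq ?_)
    rw [norm_smul, Real.norm_eq_abs, abs_of_nonneg (sub_nonneg.2 hTle)]
  have hmain := sum_omegaAt_mul_dist_le (σ := σ) (y := y) m _ hδ
  have hpsi := psiAt_le (y := y) hG hσ m
  rw [hsum] at hpsi
  have hS := sum_norm_velAfter_le (σ := σ) (y := y) m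
  rw [hm]
  calc _ ≤ psiAt σ N y m + 3 * ∑ i, (Δ - T.toReal) * ‖velAfter σ N y m i‖ +
        3 * ∑ k, (Δ - T.toReal) * ‖velAfter σ N y m k‖ := hmain
    _ = psiAt σ N y m + 6 * (Δ - T.toReal) * ∑ j, ‖velAfter σ N y m j‖ := by
        rw [← Finset.mul_sum]; ring
    _ ≤ (6 * sBar N y * T.toReal + 6 * hsDiameter σ N * m) + 6 * (Δ - T.toReal) * sBar N y := by
        have := mul_le_mul_of_nonneg_left hS
          (mul_nonneg (by norm_num : (0:ℝ) ≤ 6) (sub_nonneg.2 hTle))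
        linarith
    _ = 6 * sBar N y * Δ + 6 * hsDiameter σ N * m := by ring

/-- `S̄` is constant along a good orbit (energy conservation). -/
theorem sBar_flow (Φ : Flow σ N) {z : Cfg N} (hz : z ∈ Φ.good) (s : ℝ) :
    sBar N (Φ.flow s z) = sBar N z := by
  unfold sBar
  rw [Reduction.sum_sq_flow Φ hz s]

/-- **Locality of the carrier masses along a hard-sphere flow** (`0 < σ < 1/2`, good datum `z`,
window `[s₀, s₀ + Δ]`): `Σ_k Σ_i ω_{ki} d(x_i(s₀+Δ), x_k(s₀+Δ)) ≤ 6 S̄(z) Δ + 6 ε_N m` for the fold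
restarted at `Φ_{s₀} z` with `m = steps … Δ` steps — the fold started at a point of a good orbit is
forward-good and its forward flow is the orbit (`IsHardSphereTrajectory.fwdGood_apply_zero`,
`fwdFlow_apply_zero`, group law). -/
theorem locality_flow (hσ : 0 < σ) (hσ2 : σ < 2⁻¹) (Φ : Flow σ N) {z : Cfg N} (hz : z ∈ Φ.good)
    (s₀ : ℝ) {Δ : ℝ} (hΔ : 0 ≤ Δ) :
    ∑ k, ∑ i, omegaAt σ N (Φ.flow s₀ z) (steps σ N (Φ.flow s₀ z) Δ) k i *
        Torus.euclidDist (Φ.flow (s₀ + Δ) z i).1 (Φ.flow (s₀ + Δ) z k).1 ≤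
      6 * sBar N z * Δ + 6 * hsDiameter σ N * steps σ N (Φ.flow s₀ z) Δ := by
  have hG := FlowDict.regular_hsDiameter hσ.le hσ2 N
  set y := Φ.flow s₀ z with hy_def
  have hy : y ∈ Φ.good := Φ.mapsTo_good s₀ hz
  have hγ := Φ.isTrajectory y hy
  have hgood : Alexander.FwdGood (Torus.geometry (Fin 3)) (hsDiameter σ N) y := by
    have h := hγ.fwdGood_apply_zero hG
    rwa [Φ.flow_zero _ hy] at h
  have hfwd : Alexander.fwdFlow (Torus.geometry (Fin 3)) (hsDiameter σ N) y Δ = Φ.flow (s₀ + Δ) z := by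
    have h := hγ.fwdFlow_apply_zero hG hΔ
    rw [Φ.flow_zero _ hy] at h
    rw [h, hy_def, ← Φ.flow_add Δ s₀ z hz, add_comm Δ s₀]
  have h := locality_fold (y := y) hG hσ hΔ hgood
  rwa [hfwd, sBar_flow Φ hz] at h

/-- **Locality over the line window** (`0 < σ < 1/2`, good datum): for every `s`, with the window
start `winStart`, its number of steps and the positions at time `s`,
`Σ_k Σ_i ω_{ki} d(x_i(s), x_k(s)) ≤ 6 S̄(z) winLen + 6 ε_N #steps`. -/
theorem locality_win (hσ : 0 < σ) (hσ2 : σ < 2⁻¹) (Φ : Flow σ N) {z : Cfg N} (hz : z ∈ Φ.good)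
    (s : ℝ) :
    ∑ k, ∑ i, omegaAt σ N (winStart σ N Φ s z) (steps σ N (winStart σ N Φ s z) (winLen N s)) k i *
        Torus.euclidDist (Φ.flow s z i).1 (Φ.flow s z k).1 ≤
      6 * sBar N z * winLen N s +
        6 * hsDiameter σ N * steps σ N (winStart σ N Φ s z) (winLen N s) := by
  have h := locality_flow hσ hσ2 Φ hz (s - winLen N s) (Reduction.winLen_nonneg N s)
  rwa [sub_add_cancel] at h

/-- Registered anchor of this helper file (the velocity scale bounds the fold speeds,
`sum_norm_velAfter_le` with `sBar` unfolded). -/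
theorem pastDamping_locality_anchor : ∀ (σ : ℝ) (N : ℕ) (y : Cfg N) (l : ℕ), ∑ j : Fin (N + 1), ‖velAfter σ N y l j‖ ≤ Real.sqrt (((N + 1 : ℕ) : ℝ) * ∑ j : Fin (N + 1), ‖(y j).2‖ ^ 2) :=
  fun _ _ _ l => sum_norm_velAfter_le l

end

end PastDamping
end Summit.AtomisticToContinuum.HydrodynamicLimit.Theorems.ContactSourceDuhamel.TimeLocal
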